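/-
Copyright: harness cell b2b-lgcu-borel (gen 6).  Honest framing: the VALUE here is a THEOREM /
a DECIDABLE VERDICT / a CERTIFICATE — NOT summit progress.
-/
import Mathlib

/-!
# A Weil-type ceiling for the diagonal Borel family (`diagFamily`)

For multiplicative subgroups `A, B ≤ 𝔽ₚˣ` and a shift `s` with `s ≠ 0`, `s + 1 ≠ 0`, the number
`N` of solutions `(α, β) ∈ A × B` of `α + s = (s + 1) β` satisfies the character-sum estimate
`(|A| - 1)·|B| ≤ (p - 1)·(N + √p)` (orthogonality of Dirichlet characters mod `p` plus the
bound `|J(θ, χ)| ≤ √p` for Jacobi sums).  The TPP hypothesis of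
`BorelDiagonalFamily.diagFamily_tpp` (with `c = s + 1`, `R₂ = A`, `R₃ = B`) says exactly that
`(1, 1)` is the only solution, so every TPP instance of the diagonal family has
`(|R₂| - 1)·|R₃| ≤ (p - 1)(1 + √p)`: its volume `(p-1)²|R₂||R₃|` is `O(p^{7/2})`, which caps the
exponent thresholds this family can ever certify (the empirical optimum is `ε ≈ 6.0` at
`p = 241`).  VALUE = a theorem about the family, NOT summit progress.
-/

open scoped BigOperators Classical

namespace Summit.MatrixMultiplication.MatrixMultiplication.Theorems.SubgroupIdentityDesigns.Negative.ShiftedSubgroup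

variable {p : ℕ} [hp : Fact p.Prime]

/-! ## Character values: conjugation and Jacobi sums -/

/-- The complex conjugate of a character value is the value of the inverse character. -/
theorem conj_apply (χ : DirichletCharacter ℂ p) (x : ZMod p) :
    starRingEnd ℂ (χ x) = χ⁻¹ x := by
  by_cases hx : IsUnit x
  · obtain ⟨u, rfl⟩ := hx
    rw [MulChar.inv_apply_eq_inv']
    have h1 : ‖χ u‖ = 1 := DirichletCharacter.unit_norm_eq_one χ u
    rw [Complex.inv_def, Complex.normSq_eq_norm_sq, h1]
    simp
  · rw [MulChar.map_nonunit χ hx, MulChar.map_nonunit χ⁻¹ hx, map_zero]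

/-- Conjugating a Jacobi sum inverts both characters. -/
theorem conj_jacobiSum (χ ψ : DirichletCharacter ℂ p) :
    starRingEnd ℂ (jacobiSum χ ψ) = jacobiSum χ⁻¹ ψ⁻¹ := by
  unfold jacobiSum
  rw [map_sum]
  exact Finset.sum_congr rfl fun x _ => by rw [map_mul, conj_apply, conj_apply]

/-- `1 ≤ √p`. -/
theorem one_le_sqrt : (1 : ℝ) ≤ Real.sqrt p := by
  rw [Real.one_le_sqrt]
  exact_mod_cast hp.out.one_lt.le

/-- The Weil bound for Jacobi sums with a nontrivial second argument: `‖J(χ, ψ)‖ ≤ √p`. -/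
theorem norm_jacobiSum_le (χ ψ : DirichletCharacter ℂ p) (hψ : ψ ≠ 1) :
    ‖jacobiSum χ ψ‖ ≤ Real.sqrt p := by
  by_cases hχ : χ = 1
  · subst hχ
    rw [jacobiSum_one_nontrivial hψ, norm_neg, norm_one]
    exact one_le_sqrt
  by_cases hχψ : χ * ψ = 1
  · have hχ' : χ = ψ⁻¹ := eq_inv_of_mul_eq_one_left hχψ
    subst hχ'
    rw [jacobiSum_comm, jacobiSum_nontrivial_inv hψ, norm_neg]
    exact (DirichletCharacter.norm_le_one ψ _).trans one_le_sqrt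
  · have hch : ringChar ℂ ≠ ringChar (ZMod p) := by
      rw [ringChar.eq_zero, ZMod.ringChar_zmod_n]
      exact hp.out.ne_zero.symm
    have key := jacobiSum_mul_jacobiSum_inv hch hχ hψ hχψ
    rw [ZMod.card, ← conj_jacobiSum, Complex.mul_conj, Complex.normSq_eq_norm_sq] at key
    have hsq : ‖jacobiSum χ ψ‖ ^ 2 = (p : ℝ) := by exact_mod_cast key
    rw [← Real.sqrt_sq (norm_nonneg (jacobiSum χ ψ)), hsq]

/-! ## Character sums over a subgroup -/

/-- `coSum H χ = ∑_{h ∈ H} χ(h⁻¹)`. -/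
noncomputable def coSum (H : Subgroup (ZMod p)ˣ) (χ : DirichletCharacter ℂ p) : ℂ :=
  ∑ h : H, χ (((h : (ZMod p)ˣ)⁻¹ : (ZMod p)ˣ) : ZMod p)

/-- Translation invariance: `χ(h₀) · coSum H χ = coSum H χ` for `h₀ ∈ H`. -/
theorem mul_coSum (H : Subgroup (ZMod p)ˣ) (χ : DirichletCharacter ℂ p) (h₀ : H) :
    χ ((h₀ : (ZMod p)ˣ) : ZMod p) * coSum H χ = coSum H χ := by
  unfold coSum
  rw [Finset.mul_sum]
  refine Fintype.sum_bijective (fun h => h * h₀⁻¹) (Group.mulRight_bijective h₀⁻¹) _ _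
    fun h => ?_
  rw [← map_mul]
  congr 1

/-- A character sum over a subgroup is `|H|` if the character is trivial on `H`, else `0`. -/
theorem coSum_eq (H : Subgroup (ZMod p)ˣ) (χ : DirichletCharacter ℂ p) :
    coSum H χ = if (∀ h : H, χ ((h : (ZMod p)ˣ) : ZMod p) = 1) then (Nat.card H : ℂ) else 0 := by
  split_ifs with hall
  · unfold coSum
    rw [Finset.sum_congr rfl fun (h : H) _ => show
      χ (((h : (ZMod p)ˣ)⁻¹ : (ZMod p)ˣ) : ZMod p) = 1 by
        have := hall h⁻¹; rwa [Subgroup.coe_inv] at this]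
    simp [Nat.card_eq_fintype_card]
  · push Not at hall
    obtain ⟨h₀, h₀ne⟩ := hall
    exact eq_zero_of_mul_eq_self_left h₀ne (mul_coSum H χ h₀)

/-- `‖coSum H χ‖ = Re (coSum H χ)` (the sum is a non-negative real). -/
theorem norm_coSum (H : Subgroup (ZMod p)ˣ) (χ : DirichletCharacter ℂ p) :
    ‖coSum H χ‖ = (coSum H χ).re := by
  rw [coSum_eq]
  split_ifs <;> simp

/-- Orthogonality: `∑_χ coSum H χ = p - 1` (only `h = 1` contributes). -/
theorem sum_coSum (H : Subgroup (ZMod p)ˣ) :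
    ∑ χ : DirichletCharacter ℂ p, coSum H χ = (p : ℂ) - 1 := by
  unfold coSum
  rw [Finset.sum_comm, Finset.sum_eq_single (1 : H)]
  · rw [DirichletCharacter.sum_characters_eq]
    simp [Nat.totient_prime hp.out, Nat.cast_sub hp.out.one_le]
  · intro h _ hne
    rw [DirichletCharacter.sum_characters_eq, if_neg]
    rw [Units.val_eq_one, inv_eq_one, OneMemClass.coe_eq_one]
    exact hne
  · intro h1
    exact absurd (Finset.mem_univ _) h1

/-- `∑_χ ‖coSum H χ‖ = p - 1`. -/
theorem sum_norm_coSum (H : Subgroup (ZMod p)ˣ) :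
    ∑ χ : DirichletCharacter ℂ p, ‖coSum H χ‖ = (p : ℝ) - 1 := by
  simp_rw [norm_coSum]
  rw [← Complex.re_sum, sum_coSum]
  simp

/-! ## Completing a shifted sum over a subgroup -/

/-- The complete twisted sum `G s χ θ = ∑_x θ(x) χ(x + s)`. -/
noncomputable def G (s : ZMod p) (χ θ : DirichletCharacter ℂ p) : ℂ :=
  ∑ x : ZMod p, θ x * χ (x + s)

/-- For `s ≠ 0`, `G s χ θ = θ(-s) χ(s) J(θ, χ)` (substitute `x = -s·u`). -/
theorem G_eq_jacobi (s : ZMod p) (hs : s ≠ 0) (χ θ : DirichletCharacter ℂ p) :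
    G s χ θ = θ (-s) * χ s * jacobiSum θ χ := by
  unfold G jacobiSum
  rw [Finset.mul_sum]
  refine (Fintype.sum_bijective (fun u => -s * u) (mulLeft_bijective₀ (-s) (neg_ne_zero.mpr hs))
    (fun u => θ (-s) * χ s * (θ u * χ (1 - u))) (fun x => θ x * χ (x + s)) fun u => ?_).symm
  have h1 : -s * u + s = s * (1 - u) := by ring
  simp only [h1, map_mul]
  ring

/-- `‖G s χ θ‖ ≤ √p` for `χ ≠ 1`, `s ≠ 0`. -/
theorem norm_G_le (s : ZMod p) (hs : s ≠ 0) (χ θ : DirichletCharacter ℂ p) (hχ : χ ≠ 1) :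
    ‖G s χ θ‖ ≤ Real.sqrt p := by
  rw [G_eq_jacobi s hs, norm_mul, norm_mul]
  have h1 := DirichletCharacter.norm_le_one θ (-s)
  have h2 := DirichletCharacter.norm_le_one χ s
  have h3 := norm_jacobiSum_le θ χ hχ
  calc ‖θ (-s)‖ * ‖χ s‖ * ‖jacobiSum θ χ‖ ≤ 1 * 1 * Real.sqrt p := by gcongr
    _ = Real.sqrt p := by ring

/-- Inner orthogonality step of the completion identity. -/
theorem sum_char_coset (α : (ZMod p)ˣ) (x s : ZMod p) (χ : DirichletCharacter ℂ p) :
    ∑ θ : DirichletCharacter ℂ p, θ ((α⁻¹ : (ZMod p)ˣ) : ZMod p) * (θ x * χ (x + s))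
      = if (α : ZMod p) = x then ((p : ℂ) - 1) * χ (x + s) else 0 := by
  simp_rw [← mul_assoc, ← Finset.sum_mul]
  rw [Units.val_inv_eq_inv_val, DirichletCharacter.sum_char_inv_mul_char_eq ℂ (Units.isUnit α) x,
    Nat.totient_prime hp.out, Nat.cast_sub hp.out.one_le]
  split_ifs <;> simp

/-- Completion: `∑_θ coSum A θ · G s χ θ = (p - 1) · ∑_{α ∈ A} χ(α + s)`. -/
theorem expand (A : Subgroup (ZMod p)ˣ) (s : ZMod p) (χ : DirichletCharacter ℂ p) :
    ∑ θ : DirichletCharacter ℂ p, coSum A θ * G s χ θ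
      = ((p : ℂ) - 1) * ∑ α : A, χ ((α : (ZMod p)ˣ) + s) := by
  calc ∑ θ : DirichletCharacter ℂ p, coSum A θ * G s χ θ
      = ∑ θ : DirichletCharacter ℂ p, ∑ α : A, ∑ x : ZMod p,
          θ (((α : (ZMod p)ˣ)⁻¹ : (ZMod p)ˣ) : ZMod p) * (θ x * χ (x + s)) := by
        simp_rw [coSum, G, Finset.sum_mul, Finset.mul_sum]
    _ = ∑ α : A, ∑ x : ZMod p, ∑ θ : DirichletCharacter ℂ p,
          θ (((α : (ZMod p)ˣ)⁻¹ : (ZMod p)ˣ) : ZMod p) * (θ x * χ (x + s)) := by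
        rw [Finset.sum_comm]
        exact Finset.sum_congr rfl fun α _ => Finset.sum_comm
    _ = ∑ α : A, ∑ x : ZMod p,
          (if ((α : (ZMod p)ˣ) : ZMod p) = x then ((p : ℂ) - 1) * χ (x + s) else 0) := by
        simp_rw [sum_char_coset]
    _ = ∑ α : A, ((p : ℂ) - 1) * χ ((α : (ZMod p)ˣ) + s) := by
        refine Finset.sum_congr rfl fun α _ => ?_
        rw [Finset.sum_ite_eq, if_pos (Finset.mem_univ _)]
    _ = ((p : ℂ) - 1) * ∑ α : A, χ ((α : (ZMod p)ˣ) + s) := by rw [Finset.mul_sum]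

/-- The shifted sum over a subgroup: `‖∑_{α ∈ A} χ(α + s)‖ ≤ √p` for `χ ≠ 1`, `s ≠ 0`. -/
theorem norm_shiftSum_le (A : Subgroup (ZMod p)ˣ) (s : ZMod p) (hs : s ≠ 0)
    (χ : DirichletCharacter ℂ p) (hχ : χ ≠ 1) :
    ‖∑ α : A, χ ((α : (ZMod p)ˣ) + s)‖ ≤ Real.sqrt p := by
  have hp1 : (0 : ℝ) < (p : ℝ) - 1 := by
    have := hp.out.one_lt; rw [sub_pos]; exact_mod_cast this
  have key := expand A s χ
  have hn : ‖((p : ℂ) - 1) * ∑ α : A, χ ((α : (ZMod p)ˣ) + s)‖ ≤ ((p : ℝ) - 1) * Real.sqrt p := by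
    rw [← key]
    calc ‖∑ θ : DirichletCharacter ℂ p, coSum A θ * G s χ θ‖
        ≤ ∑ θ : DirichletCharacter ℂ p, ‖coSum A θ * G s χ θ‖ := norm_sum_le _ _
      _ ≤ ∑ θ : DirichletCharacter ℂ p, ‖coSum A θ‖ * Real.sqrt p := by
          refine Finset.sum_le_sum fun θ _ => ?_
          rw [norm_mul]
          exact mul_le_mul_of_nonneg_left (norm_G_le s hs χ θ hχ) (norm_nonneg _)
      _ = ((p : ℝ) - 1) * Real.sqrt p := by rw [← Finset.sum_mul, sum_norm_coSum]
  rw [norm_mul] at hn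
  have hc : ‖(p : ℂ) - 1‖ = (p : ℝ) - 1 := by
    rw [show (p : ℂ) - 1 = (((p : ℝ) - 1 : ℝ) : ℂ) by push_cast; ring, Complex.norm_real,
      Real.norm_eq_abs, abs_of_pos hp1]
  rw [hc] at hn
  exact le_of_mul_le_mul_left hn hp1

/-! ## Counting solutions of `α + s = (s+1)·β` -/

/-- The number of solutions `(α, β) ∈ A × B` of `α + s = (s + 1)·β`. -/
noncomputable def solCount (A B : Subgroup (ZMod p)ˣ) (s : ZMod p) : ℕ :=
  Fintype.card {ab : A × B //
    (s + 1) * ((ab.2 : (ZMod p)ˣ) : ZMod p) = ((ab.1 : (ZMod p)ˣ) : ZMod p) + s}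

/-- `solCount` as a double sum of indicators. -/
theorem solCount_eq_sum (A B : Subgroup (ZMod p)ˣ) (s : ZMod p) :
    (solCount A B s : ℂ) = ∑ α : A, ∑ β : B,
      (if (s + 1) * ((β : (ZMod p)ˣ) : ZMod p) = ((α : (ZMod p)ˣ) : ZMod p) + s
        then (1 : ℂ) else 0) := by
  unfold solCount
  rw [Fintype.card_subtype, Finset.card_filter, Nat.cast_sum, Fintype.sum_prod_type]
  simp only [Nat.cast_ite, Nat.cast_one, Nat.cast_zero]

/-- Inner orthogonality step of the counting identity. -/
theorem sum_char_sol (s : ZMod p) (hs1 : s + 1 ≠ 0) (a : ZMod p) (β : (ZMod p)ˣ) :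
    ∑ χ : DirichletCharacter ℂ p, χ (s + 1)⁻¹ * χ a * χ ((β⁻¹ : (ZMod p)ˣ) : ZMod p)
      = if (s + 1) * (β : ZMod p) = a then ((p : ℂ) - 1) else 0 := by
  have hu : IsUnit ((s + 1) * (β : ZMod p)) := (IsUnit.mk0 _ hs1).mul (Units.isUnit β)
  have key := DirichletCharacter.sum_char_inv_mul_char_eq ℂ hu a
  rw [Nat.totient_prime hp.out, Nat.cast_sub hp.out.one_le, Nat.cast_one] at key
  rw [← key]
  refine Finset.sum_congr rfl fun χ _ => ?_
  rw [mul_inv, Units.val_inv_eq_inv_val, map_mul]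
  ring

/-- The counting identity:
`(p - 1) · solCount = ∑_χ χ((s+1)⁻¹) · (∑_{α ∈ A} χ(α + s)) · coSum B χ`. -/
theorem count_identity (A B : Subgroup (ZMod p)ˣ) (s : ZMod p) (hs1 : s + 1 ≠ 0) :
    ((p : ℂ) - 1) * (solCount A B s : ℂ)
      = ∑ χ : DirichletCharacter ℂ p,
          χ (s + 1)⁻¹ * (∑ α : A, χ ((α : (ZMod p)ˣ) + s)) * coSum B χ := by
  symm
  calc ∑ χ : DirichletCharacter ℂ p,
          χ (s + 1)⁻¹ * (∑ α : A, χ ((α : (ZMod p)ˣ) + s)) * coSum B χ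
      = ∑ χ : DirichletCharacter ℂ p, ∑ β : B, ∑ α : A,
          χ (s + 1)⁻¹ * χ ((α : (ZMod p)ˣ) + s) * χ (((β : (ZMod p)ˣ)⁻¹ : (ZMod p)ˣ) : ZMod p) := by
        simp_rw [coSum, Finset.mul_sum, Finset.sum_mul]
    _ = ∑ α : A, ∑ β : B, ∑ χ : DirichletCharacter ℂ p,
          χ (s + 1)⁻¹ * χ ((α : (ZMod p)ˣ) + s) * χ (((β : (ZMod p)ˣ)⁻¹ : (ZMod p)ˣ) : ZMod p) := by
        rw [Finset.sum_comm]
        exact (Finset.sum_congr rfl fun β _ => Finset.sum_comm).trans Finset.sum_comm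
    _ = ∑ α : A, ∑ β : B,
          (if (s + 1) * ((β : (ZMod p)ˣ) : ZMod p) = ((α : (ZMod p)ˣ) : ZMod p) + s
            then ((p : ℂ) - 1) else 0) := by
        simp_rw [sum_char_sol s hs1]
    _ = ((p : ℂ) - 1) * (solCount A B s : ℂ) := by
        rw [solCount_eq_sum, Finset.mul_sum]
        refine Finset.sum_congr rfl fun α _ => ?_
        rw [Finset.mul_sum]
        refine Finset.sum_congr rfl fun β _ => ?_
        split_ifs <;> ring

/-- The trivial-character term: `Re (∑_{α ∈ A} 1(α + s)) ≥ |A| - 1`. -/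
theorem re_shiftSum_one_ge (A : Subgroup (ZMod p)ˣ) (s : ZMod p) :
    (Nat.card A : ℝ) - 1 ≤ (∑ α : A, (1 : DirichletCharacter ℂ p) ((α : (ZMod p)ˣ) + s)).re := by
  have hterm : ∀ α : A, (1 : DirichletCharacter ℂ p) ((α : (ZMod p)ˣ) + s)
      = 1 - (if ((α : (ZMod p)ˣ) : ZMod p) + s = 0 then (1 : ℂ) else 0) := by
    intro α
    by_cases h0 : ((α : (ZMod p)ˣ) : ZMod p) + s = 0
    · rw [MulChar.map_nonunit _ (by rw [isUnit_iff_ne_zero]; exact fun h => h h0), if_pos h0]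
      simp
    · rw [MulChar.one_apply (isUnit_iff_ne_zero.mpr h0), if_neg h0]
      simp
  simp_rw [hterm, Finset.sum_sub_distrib, Complex.sub_re, Complex.re_sum]
  simp only [Finset.sum_const, Finset.card_univ, nsmul_eq_mul, mul_one,
    Complex.one_re, Nat.card_eq_fintype_card]
  have hle : ∑ α : A, (if ((α : (ZMod p)ˣ) : ZMod p) + s = 0 then (1 : ℂ) else 0).re ≤ 1 := by
    rw [← Complex.re_sum]
    have : (∑ α : A, (if ((α : (ZMod p)ˣ) : ZMod p) + s = 0 then (1 : ℂ) else 0))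
        = ((Finset.univ.filter fun α : A => ((α : (ZMod p)ˣ) : ZMod p) + s = 0).card : ℂ) := by
      rw [Finset.card_filter]; push_cast; rfl
    rw [this, Complex.natCast_re]
    have hcard : (Finset.univ.filter fun α : A => ((α : (ZMod p)ˣ) : ZMod p) + s = 0).card ≤ 1 := by
      refine Finset.card_le_one.mpr fun a ha b hb => ?_
      rw [Finset.mem_filter] at ha hb
      have hab : ((a : (ZMod p)ˣ) : ZMod p) = ((b : (ZMod p)ˣ) : ZMod p) := by
        rw [← add_left_inj s, ha.2, hb.2]
      exact Subtype.ext (Units.ext hab)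
    exact_mod_cast hcard
  linarith

/-- **Main estimate.** For subgroups `A, B ≤ 𝔽ₚˣ` and `s` with `s ≠ 0`, `s + 1 ≠ 0`:
`(|A| - 1)·|B| ≤ (p - 1)·(solCount A B s + √p)`. -/
theorem shifted_subgroup_count (A B : Subgroup (ZMod p)ˣ) (s : ZMod p) (hs : s ≠ 0)
    (hs1 : s + 1 ≠ 0) :
    ((Nat.card A : ℝ) - 1) * Nat.card B
      ≤ ((p : ℝ) - 1) * (solCount A B s + Real.sqrt p) := by
  -- abbreviations
  set f : DirichletCharacter ℂ p → ℂ :=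
    fun χ => χ (s + 1)⁻¹ * (∑ α : A, χ ((α : (ZMod p)ˣ) + s)) * coSum B χ with hf
  have hid : ((p : ℂ) - 1) * (solCount A B s : ℂ) = ∑ χ : DirichletCharacter ℂ p, f χ :=
    count_identity A B s hs1
  have hsplit : ∑ χ : DirichletCharacter ℂ p, f χ
      = f 1 + ∑ χ ∈ (Finset.univ : Finset (DirichletCharacter ℂ p)).erase 1, f χ :=
    (Finset.add_sum_erase _ f (Finset.mem_univ _)).symm
  -- the trivial term
  have hu : IsUnit (s + 1)⁻¹ := isUnit_iff_ne_zero.mpr (inv_ne_zero hs1)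
  have h11 : (1 : DirichletCharacter ℂ p) (s + 1)⁻¹ = 1 := MulChar.one_apply hu
  have hB1 : coSum B 1 = (Nat.card B : ℂ) := by
    rw [coSum_eq, if_pos fun h => MulChar.one_apply (Units.isUnit _)]
  have hf1 : f 1 = (∑ α : A, (1 : DirichletCharacter ℂ p) ((α : (ZMod p)ˣ) + s))
      * (Nat.card B : ℂ) := by
    simp only [hf, h11, one_mul, hB1]
  have hre1 : ((Nat.card A : ℝ) - 1) * Nat.card B ≤ (f 1).re := by
    rw [hf1, Complex.mul_re, Complex.natCast_re, Complex.natCast_im, mul_zero, sub_zero]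
    exact mul_le_mul_of_nonneg_right (re_shiftSum_one_ge A s) (Nat.cast_nonneg _)
  -- the error term
  have herr : ‖∑ χ ∈ (Finset.univ : Finset (DirichletCharacter ℂ p)).erase 1, f χ‖
      ≤ ((p : ℝ) - 1) * Real.sqrt p := by
    calc ‖∑ χ ∈ (Finset.univ : Finset (DirichletCharacter ℂ p)).erase 1, f χ‖
        ≤ ∑ χ ∈ (Finset.univ : Finset (DirichletCharacter ℂ p)).erase 1, ‖f χ‖ := norm_sum_le _ _
      _ ≤ ∑ χ ∈ (Finset.univ : Finset (DirichletCharacter ℂ p)).erase 1,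
            Real.sqrt p * ‖coSum B χ‖ := by
          refine Finset.sum_le_sum fun χ hχ => ?_
          have hχ1 : χ ≠ 1 := Finset.ne_of_mem_erase hχ
          simp only [hf, norm_mul]
          have h1 : ‖χ (s + 1)⁻¹‖ ≤ 1 := DirichletCharacter.norm_le_one χ _
          have h2 := norm_shiftSum_le A s hs χ hχ1
          calc ‖χ (s + 1)⁻¹‖ * ‖∑ α : A, χ ((α : (ZMod p)ˣ) + s)‖ * ‖coSum B χ‖
              ≤ 1 * Real.sqrt p * ‖coSum B χ‖ := by gcongr
            _ = Real.sqrt p * ‖coSum B χ‖ := by ring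
      _ ≤ ∑ χ : DirichletCharacter ℂ p, Real.sqrt p * ‖coSum B χ‖ :=
          Finset.sum_le_sum_of_subset_of_nonneg (Finset.erase_subset _ _)
            fun χ _ _ => mul_nonneg (Real.sqrt_nonneg _) (norm_nonneg _)
      _ = ((p : ℝ) - 1) * Real.sqrt p := by rw [← Finset.mul_sum, sum_norm_coSum, mul_comm]
  -- combine real parts
  have hre : (((p : ℂ) - 1) * (solCount A B s : ℂ)).re = ((p : ℝ) - 1) * solCount A B s := by
    simp [Complex.mul_re]
  have hmain : ((p : ℝ) - 1) * solCount A B s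
      = (f 1).re + (∑ χ ∈ (Finset.univ : Finset (DirichletCharacter ℂ p)).erase 1, f χ).re := by
    rw [← hre, hid, hsplit, Complex.add_re]
  have hlow := (abs_le.mp (Complex.abs_re_le_norm
    (∑ χ ∈ (Finset.univ : Finset (DirichletCharacter ℂ p)).erase 1, f χ))).1
  nlinarith [hre1, herr, hmain, hlow, Real.sqrt_nonneg (p : ℝ)]

/-- **Corollary (TPP ceiling for the diagonal family).**  In the notation of
`BorelDiagonalFamily.diagFamily_tpp` (`c = s + 1`): if the TPP condition
`c(y₃ - 1) + (y₂ - 1)y₃ = 0 → y₂ = y₃ = 1` holds on `R₂ × R₃` with `c ≠ 0, 1`, then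
`(|R₂| - 1)·|R₃| ≤ (p - 1)(1 + √p)`; hence the family's volume `(p-1)²|R₂||R₃|` is `O(p^{7/2})`. -/
theorem diagFamily_tpp_card_le (R₂ R₃ : Subgroup (ZMod p)ˣ) (c : ZMod p) (hc0 : c ≠ 0)
    (hc1 : c ≠ 1)
    (hT : ∀ y₂ ∈ R₂, ∀ y₃ ∈ R₃,
      c * ((y₃ : ZMod p) - 1) + ((y₂ : ZMod p) - 1) * y₃ = 0 → y₂ = 1 ∧ y₃ = 1) :
    ((Nat.card R₂ : ℝ) - 1) * Nat.card R₃ ≤ ((p : ℝ) - 1) * (1 + Real.sqrt p) := by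
  set s : ZMod p := c - 1 with hs_def
  have hs : s ≠ 0 := sub_ne_zero.mpr hc1
  have hs1 : s + 1 ≠ 0 := by rw [hs_def, sub_add_cancel]; exact hc0
  have hN : solCount R₂ R₃ s ≤ 1 := by
    unfold solCount
    refine Fintype.card_le_one_iff_subsingleton.mpr ⟨fun ⟨⟨a, b⟩, hab⟩ ⟨⟨a', b'⟩, hab'⟩ => ?_⟩
    have sol : ∀ (y₂ : R₂) (y₃ : R₃),
        (s + 1) * ((y₃ : (ZMod p)ˣ) : ZMod p) = ((y₂ : (ZMod p)ˣ) : ZMod p) + s →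
        y₂ = 1 ∧ y₃ = 1 := by
      intro y₂ y₃ h
      symm at h
      have h3 := hT y₂ y₂.2 ((y₃ : (ZMod p)ˣ)⁻¹) (inv_mem y₃.2) (by
        rw [hs_def, sub_add_cancel] at h
        have hy : ((y₃ : (ZMod p)ˣ) : ZMod p) * (((y₃ : (ZMod p)ˣ)⁻¹ : (ZMod p)ˣ) : ZMod p) = 1 := by
          rw [← Units.val_mul, mul_inv_cancel, Units.val_one]
        linear_combination (((y₃ : (ZMod p)ˣ)⁻¹ : (ZMod p)ˣ) : ZMod p) * h + c * hy)
      refine ⟨OneMemClass.coe_eq_one.mp h3.1, ?_⟩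
      have := h3.2
      rw [inv_eq_one] at this
      exact OneMemClass.coe_eq_one.mp this
    obtain ⟨rfl, rfl⟩ := sol a b hab
    obtain ⟨rfl, rfl⟩ := sol a' b' hab'
    rfl
  have key := shifted_subgroup_count R₂ R₃ s hs hs1
  have hN' : (solCount R₂ R₃ s : ℝ) ≤ 1 := by exact_mod_cast hN
  have hp1 : (0 : ℝ) ≤ (p : ℝ) - 1 := by
    have := hp.out.one_lt; rw [sub_nonneg]; exact_mod_cast this.le
  nlinarith [key, hN', hp1, Real.sqrt_nonneg (p : ℝ)]

end Summit.MatrixMultiplication.MatrixMultiplication.Theorems.SubgroupIdentityDesigns.Negative.ShiftedSubgroup
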